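import Literature.Analysis.FluidPDE.DuchonRobertLionsEnergyEquality
import Literature.Analysis.FluidPDE.DuchonRobertMollifiedTransport
import Literature.Analysis.FunctionSpaces.TorusFourierConvolution
import HarnessLib

/-!
# Lions' energy equality in `L⁴(0,T; L⁴(T^d))` in every dimension

Analysis/FluidPDE file (theorem-only), completing `FluidPDE/DuchonRobertLionsEnergyEquality`:
the corrected form of the refuted fact `Literature.Analysis.FluidPDE.lions_energy_equality` is
proved there for `2 ≤ d ≤ 4` (`lions_energy_equality_Ioc`), the dimension entering only through
the embedding `H¹(T^d) ⊂ L⁴(T^d)` used to control the nonlinear term `∫⟪u, (u·∇)P_N u⟫`. Here that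
single step is redone by **mollification**, which is `L⁴`-stable in every dimension (this is the
dimension-free mechanism of Shinbrot's proof, SIAM J. Math. Anal. 5 (1974)), and the energy
equality follows on `T^d` for every finite `d`:
`Literature.Analysis.FluidPDE.lions_energy_equality_Ioc'`.

## Contents

* `Torus.mFourierCoeff_convolution_of_integrable_left` — the convolution theorem
  `𝓕(θ ⋆ w) = 𝓕θ · 𝓕w` on `T^d` for `θ ∈ L¹` real and `w` continuous (Grafakos 2014,
  Prop. 3.1.2 (9); the tree's `Torus.mFourierCoeff_convolution` assumes `θ` continuous);
  `Torus.mFourierCoeff_complexify_vecConv` — `𝓕(w ⋆ K) = 𝓕K • 𝓕w` for vector fields;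
  `Torus.norm_mFourierCoeff_kernel_le_one`, `Torus.eGradNormSq_vecConv_le` — mollification by a
  nonnegative unit-mass kernel does not increase `‖∇·‖₂` (spectrally).
* `Torus.tendsto_mFourierCoeff_kernel` — `𝓕(kernel εₙ)(k) → 1` along `εₙ → 0⁺`;
  `Torus.tendsto_eGradNormSq_fourierTruncate_sub_vecConv` — `‖∇(P_N v - P_N v ⋆ kernel εₙ)‖₂ → 0`.
* `Torus.enorm_integral_inner_convect_fourierTruncate_self_le_of_isWeaklyDivFree` — **the key
  slice estimate, every dimension**: for `v ∈ L² ∩ L⁴` weakly divergence free with `‖∇v‖₂ < ∞`,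
  `‖∫⟪v, (v·∇)P_N v⟫‖ ≤ ‖v‖₄² ‖∇(P_N v - v)‖₂` (the rigorous `b(v,v,P_N v) = -b(v,v,v - P_N v)`:
  split `P_N v = (P_N v - P_N v ⋆ Kₙ) + (P_N v - v) ⋆ Kₙ + v ⋆ Kₙ`; the last field contributes
  `∫⟪v - v ⋆ Kₙ, (v·∇)(v ⋆ Kₙ)⟫` by weak incompressibility, `→ 0` by the `L⁴` approximate identity;
  the first `→ 0`; the middle one is bounded by `‖v‖₄² ‖∇(P_N v - v)‖₂`);
  `Torus.tendsto_eGradNormSq_fourierTruncate_sub` — `‖∇(P_N v - v)‖₂ → 0`.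
* `Torus.IsLerayHopfOn.tendsto_setIntegral_inner_convect_fourierTruncate_self'` and
  `lions_energy_equality_Ioc'` — the time integration (dominated by `‖u‖₄²‖∇u‖₂ ∈ L¹ₜ`) and the
  assembly, verbatim as in the `d ≤ 4` file.

## References

* J.-L. Lions, Rend. Sem. Mat. Univ. Padova 30 (1960), 16–23.
* M. Shinbrot, *The energy equation for the Navier–Stokes system*, SIAM J. Math. Anal. 5 (1974),
  948–954. [Shinbrot1974]
* J. Serrin, *The initial value problem for the Navier–Stokes equations*, 1963, §4. [Serrin1963]
* L. Grafakos, *Classical Fourier Analysis*, 3rd ed. (2014), Prop. 3.1.2 (9). [Grafakos2014]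
* L. C. Evans, *Partial Differential Equations*, 2nd ed. (2010), App. C.4, Thm. 7. [Evans2010]
-/

noncomputable section

open MeasureTheory TopologicalSpace Set Function Filter Topology UnitAddTorus Metric
open scoped InnerProductSpace RealInnerProductSpace ENNReal NNReal ContDiff Convolution ComplexConjugate

namespace Literature.Analysis.FluidPDE

namespace Torus

variable {d : Type*} [Fintype d] [DecidableEq d]

/-! ### Fourier coefficients of mollified fields -/

section Fourier

omit [DecidableEq d] in
/-- **Convolution theorem on `T^d`, integrable left factor** (Grafakos 2014, Prop. 3.1.2 (9)):
for a real `θ ∈ L¹(T^d)` and a continuous complex `w`, `𝓕(θ ⋆ w)(k) = 𝓕θ(k) 𝓕w(k)`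
(`(θ ⋆ w)(x) = ∫ θ(y) w(x - y) dy`; Fubini, the integrand being integrable on `T^d × T^d` by
Mathlib's `Integrable.convolution_integrand`; twin of `Torus.mFourierCoeff_convolution`, which
assumes `θ` continuous). [cite: Grafakos2014, Prop. 3.1.2 (9)] -/
theorem mFourierCoeff_convolution_of_integrable_left {θ : UnitAddTorus d → ℝ} (hθ : Integrable θ volume)
    {w : UnitAddTorus d → ℂ} (hw : Continuous w) (k : d → ℤ) :
    mFourierCoeff (θ ⋆ w) k = mFourierCoeff (fun x => (θ x : ℂ)) k * mFourierCoeff w k := by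
  simp only [FunctionSpaces.Torus.mFourierCoeff_eq_integral_conj_mul]
  -- the integrand on `T^d × T^d`
  set Φ : UnitAddTorus d → UnitAddTorus d → ℂ :=
    fun x y => conj (mFourier k x) * ((θ y : ℂ) * w (x - y)) with hΦ_def
  have hwi : Integrable w volume := hw.integrable_of_hasCompactSupport (HasCompactSupport.of_compactSpace _)
  have hΦi : Integrable (uncurry Φ) ((volume : Measure (UnitAddTorus d)).prod volume) := by
    have h1 : Integrable (fun p : UnitAddTorus d × UnitAddTorus d => (θ p.2 : ℂ) * w (p.1 - p.2))
        ((volume : Measure (UnitAddTorus d)).prod volume) := by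
      have h := hθ.convolution_integrand (ContinuousLinearMap.lsmul ℝ ℝ) hwi
      refine h.congr (ae_of_all _ fun p => ?_)
      simp only [ContinuousLinearMap.lsmul_apply, Complex.real_smul]
    have h2 : Integrable (fun p : UnitAddTorus d × UnitAddTorus d =>
        conj (mFourier k p.1) * ((θ p.2 : ℂ) * w (p.1 - p.2))) ((volume : Measure (UnitAddTorus d)).prod volume) := by
      refine h1.bdd_mul (c := 1) ?_ (ae_of_all _ fun p => ?_)
      · exact (Complex.continuous_conj.comp ((mFourier k).continuous.comp continuous_fst)).aestronglyMeasurable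
      · rw [Complex.norm_conj]
        exact ((mFourier k).norm_coe_le_norm p.1).trans_eq mFourier_norm
    exact h2
  calc ∫ x, conj (mFourier k x) * (θ ⋆ w) x
      = ∫ x, ∫ y, Φ x y := by
        refine integral_congr_ae (ae_of_all _ fun x => ?_)
        simp only [hΦ_def, convolution_lsmul, Complex.real_smul, ← integral_const_mul]
    _ = ∫ y, ∫ x, Φ x y := integral_integral_swap hΦi
    _ = ∫ y, conj (mFourier k y) * (θ y : ℂ) * ∫ x, conj (mFourier k x) * w x := by
        refine integral_congr_ae (ae_of_all _ fun y => ?_)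
        beta_reduce
        have h1 : ∫ x, Φ x y = ∫ x, Φ (x + y) y := (integral_add_right_eq_self (fun x => Φ x y) y).symm
        rw [h1, ← integral_const_mul]
        refine integral_congr_ae (ae_of_all _ fun x => ?_)
        simp only [hΦ_def, add_sub_cancel_right, FunctionSpaces.Torus.mFourier_apply_add, map_mul]
        ring
    _ = (∫ y, conj (mFourier k y) * (θ y : ℂ)) * ∫ x, conj (mFourier k x) * w x :=
        integral_mul_const _ _

omit [DecidableEq d] in
/-- **Fourier coefficients of a mollified vector field**: for `w ∈ L¹(T^d; ℝ^d)` and a continuous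
real kernel `K`, `𝓕(complexify ∘ (w ⋆ K))(k) = 𝓕K(k) • 𝓕(complexify ∘ w)(k)` (componentwise
convolution theorem). [folklore] -/
theorem mFourierCoeff_complexify_vecConv {w : UnitAddTorus d → EuclideanSpace ℝ d} (hw : Integrable w volume)
    {K : UnitAddTorus d → ℝ} (hK : Continuous K) (k : d → ℤ) :
    mFourierCoeff (FunctionSpaces.EuclideanSpace.complexify ∘ vecConv w K) k =
      mFourierCoeff (fun x => (K x : ℂ)) k • mFourierCoeff (FunctionSpaces.EuclideanSpace.complexify ∘ w) k := by
  have hint : Integrable (vecConv w K) volume := (continuous_vecConv hw hK).integrable_unitAddTorus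
  ext i
  rw [FunctionSpaces.Torus.mFourierCoeff_complexify_apply hint k i, PiLp.smul_apply, smul_eq_mul,
    FunctionSpaces.Torus.mFourierCoeff_complexify_apply hw k i]
  have h1 : (fun x => ((vecConv w K x) i : ℂ)) = (fun y => w y i) ⋆ (fun y => (K y : ℂ)) := by
    funext x
    rw [vecConv_apply, FunctionSpaces.Torus.ofReal_convolution]
  rw [h1, mFourierCoeff_convolution_of_integrable_left (w := fun y => (K y : ℂ)) (hw.eval_piLp i)
    (by exact Complex.continuous_ofReal.comp hK), mul_comm]

omit [DecidableEq d] in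
/-- The Fourier coefficients of a nonnegative continuous kernel of unit mass have modulus at
most one: `‖𝓕K(k)‖ ≤ ∫ K = 1`. [folklore] -/
theorem norm_mFourierCoeff_kernel_le_one {K : UnitAddTorus d → ℝ} (hK : Continuous K)
    (hK0 : ∀ y, 0 ≤ K y) (hK1 : ∫ y, K y = 1) (k : d → ℤ) :
    ‖mFourierCoeff (fun x => (K x : ℂ)) k‖ ≤ 1 := by
  have hKi : Integrable (fun x => (K x : ℂ)) volume :=
    (Complex.continuous_ofReal.comp hK).integrable_of_hasCompactSupport (HasCompactSupport.of_compactSpace _)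
  refine (norm_mFourierCoeff_le_integral_norm hKi k).trans (le_of_eq ?_)
  have h : (fun x => ‖(K x : ℂ)‖) = K := by
    funext x
    rw [Complex.norm_real, Real.norm_of_nonneg (hK0 x)]
  rw [h, hK1]

omit [DecidableEq d] in
/-- **Mollification does not increase the dissipation**: `‖∇(w ⋆ K)‖₂² ≤ ‖∇w‖₂²` (spectrally,
`Torus.eGradNormSq`) for `w ∈ L¹(T^d; ℝ^d)` and a nonnegative continuous kernel of unit mass
(`|𝓕K| ≤ 1` termwise in `4π² ∑ₖ |k|² ‖𝓕(w ⋆ K)(k)‖²`). [folklore] -/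
theorem eGradNormSq_vecConv_le {w : UnitAddTorus d → EuclideanSpace ℝ d} (hw : Integrable w volume)
    {K : UnitAddTorus d → ℝ} (hK : Continuous K) (hK0 : ∀ y, 0 ≤ K y) (hK1 : ∫ y, K y = 1) :
    FunctionSpaces.Torus.eGradNormSq (vecConv w K) ≤ FunctionSpaces.Torus.eGradNormSq w := by
  rw [FunctionSpaces.Torus.eGradNormSq_eq_tsum, FunctionSpaces.Torus.eGradNormSq_eq_tsum]
  refine mul_le_mul' le_rfl (ENNReal.tsum_le_tsum fun k => mul_le_mul' le_rfl ?_)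
  rw [mFourierCoeff_complexify_vecConv hw hK k, enorm_smul, mul_pow]
  refine mul_le_of_le_one_left bot_le ?_
  have h1 : ‖mFourierCoeff (fun x => (K x : ℂ)) k‖ₑ ≤ 1 := by
    rw [← ofReal_norm, ← ENNReal.ofReal_one]
    exact ENNReal.ofReal_le_ofReal (norm_mFourierCoeff_kernel_le_one hK hK0 hK1 k)
  calc ‖mFourierCoeff (fun x => (K x : ℂ)) k‖ₑ ^ 2 ≤ 1 ^ 2 := pow_le_pow_left' h1 2
    _ = 1 := one_pow 2

end Fourier

/-! ### The standard torus mollifiers along a sequence of scales -/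

section Kernels

omit [DecidableEq d] in
/-- **The Fourier coefficients of the torus mollifiers tend to one**: along scales
`εₙ → 0⁺` (`εₙ ≤ 1/4`), `𝓕(kernel εₙ)(k) → 1` for every frequency `k` — `𝓕K(k) - 1 =
∫ (e_{-k}(y) - 1) K(y) dy` for a unit-mass kernel, `K ≥ 0` is supported in the ball of radius
`εₙ`, and `e_{-k}` is continuous at `0` with `e_{-k}(0) = 1` (Evans, App. C.4, Thm. 7). [folklore] -/
theorem tendsto_mFourierCoeff_kernel {ε : ℕ → ℝ} (hε : ∀ n, 0 < ε n) (hε' : ∀ n, ε n ≤ 1 / 4)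
    (hε0 : Tendsto ε atTop (𝓝 0)) (k : d → ℤ) :
    Tendsto (fun n => mFourierCoeff (fun x => (FunctionSpaces.Torus.kernel (ε n) x : ℂ)) k) atTop (𝓝 1) := by
  rw [Metric.tendsto_atTop]
  intro δ hδ
  -- continuity of the character at `0`
  have hcont : ContinuousAt (fun y : UnitAddTorus d => mFourier (-k) y) 0 := (mFourier (-k)).continuous.continuousAt
  have h0 : mFourier (-k) (0 : UnitAddTorus d) = 1 := by
    simp [mFourier]
  obtain ⟨r, hr, hry⟩ := Metric.continuousAt_iff.1 hcont (δ / 2) (half_pos hδ)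
  obtain ⟨N₀, hN₀⟩ : ∃ N₀, ∀ n ≥ N₀, ε n < r := by
    have h := (hε0.eventually (gt_mem_nhds hr))
    rw [eventually_atTop] at h
    exact h
  refine ⟨N₀, fun n hn => ?_⟩
  set K : UnitAddTorus d → ℝ := FunctionSpaces.Torus.kernel (ε n) with hKdef
  have hKc : Continuous K := FunctionSpaces.Torus.continuous_kernel (hε n) (hε' n)
  have hK0 : ∀ y, 0 ≤ K y := fun y => FunctionSpaces.Torus.kernel_nonneg (hε n).le y
  have hK1 : ∫ y, K y = 1 := FunctionSpaces.Torus.integral_kernel (hε n) (hε' n)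
  have hKs : support K ⊆ ball 0 (ε n) := FunctionSpaces.Torus.support_kernel_subset (hε n)
  have hKi : Integrable K volume := hKc.integrable_of_hasCompactSupport (HasCompactSupport.of_compactSpace _)
  have hKci : Integrable (fun y => (K y : ℂ)) volume := Complex.ofRealCLM.integrable_comp hKi
  -- `𝓕K(k) - 1 = ∫ (e_{-k} - 1) K`
  have hrepr : mFourierCoeff (fun x => (K x : ℂ)) k - 1 = ∫ y, (mFourier (-k) y - 1) * (K y : ℂ) := by
    have hK1c : ∫ y, (K y : ℂ) = 1 := by
      rw [integral_complex_ofReal, hK1, Complex.ofReal_one]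
    have i1 : Integrable (fun y => mFourier (-k) y * (K y : ℂ)) volume :=
      hKci.bdd_mul (c := 1) (mFourier (-k)).continuous.aestronglyMeasurable
        (ae_of_all _ fun y => ((mFourier (-k)).norm_coe_le_norm y).trans_eq mFourier_norm)
    have hR : ∫ y, (mFourier (-k) y - 1) * (K y : ℂ) = (∫ y, mFourier (-k) y * (K y : ℂ)) - ∫ y, (K y : ℂ) := by
      rw [← integral_sub i1 hKci]
      refine integral_congr_ae (ae_of_all _ fun y => ?_)
      ring
    rw [hR, hK1c, FunctionSpaces.Torus.mFourierCoeff_eq_integral_volume]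
    simp only [smul_eq_mul]
  rw [dist_eq_norm, hrepr]
  -- pointwise bound on the support
  have hpt : ∀ y, ‖(mFourier (-k) y - 1) * (K y : ℂ)‖ ≤ δ / 2 * K y := by
    intro y
    by_cases hy : K y = 0
    · simp [hy]
    · have hyb : y ∈ ball (0 : UnitAddTorus d) (ε n) := hKs (mem_support.2 hy)
      have hyr : dist y 0 < r := (mem_ball.1 hyb).trans (hN₀ n hn)
      have h1 : ‖mFourier (-k) y - 1‖ ≤ δ / 2 := by
        have h := hry hyr
        rw [h0, dist_eq_norm] at h
        exact h.le
      rw [norm_mul, Complex.norm_real, Real.norm_of_nonneg (hK0 y)]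
      exact mul_le_mul_of_nonneg_right h1 (hK0 y)
  calc ‖∫ y, (mFourier (-k) y - 1) * (K y : ℂ)‖ ≤ ∫ y, ‖(mFourier (-k) y - 1) * (K y : ℂ)‖ :=
        norm_integral_le_integral_norm _
    _ ≤ ∫ y, δ / 2 * K y := integral_mono_of_nonneg (ae_of_all _ fun y => norm_nonneg _)
        (hKi.const_mul _) (ae_of_all _ hpt)
    _ = δ / 2 := by rw [integral_const_mul, hK1, mul_one]
    _ < δ := half_lt_self hδ

omit [DecidableEq d] in
/-- Componentwise: `vecConv (a - b) K = vecConv a K - vecConv b K` for integrable fields and a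
continuous kernel. [folklore] -/
theorem vecConv_sub {a b : UnitAddTorus d → EuclideanSpace ℝ d} (ha : Integrable a volume) (hb : Integrable b volume)
    {K : UnitAddTorus d → ℝ} (hK : Continuous K) : vecConv (a - b) K = vecConv a K - vecConv b K := by
  funext x
  ext i
  rw [Pi.sub_apply, PiLp.sub_apply, vecConv_apply, vecConv_apply, vecConv_apply]
  have h : (fun y => (a - b) y i) = (fun y => a y i) - fun y => b y i := by
    funext y; simp
  rw [h, FunctionSpaces.Torus.sub_convolution (ha.eval_piLp i) (hb.eval_piLp i) hK, Pi.sub_apply]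

/-- **The dissipation of the mollification error of a truncation vanishes**: for integrable `v`,
fixed `N` and scales `εₙ → 0⁺`, `‖∇(P_N v - (P_N v) ⋆ kernel εₙ)‖₂² → 0` — the coefficients of the
error are `(1 - 𝓕Kₙ(k)) v̂(k)` on the finite ball `|k| ≤ N` and vanish outside, and
`𝓕Kₙ(k) → 1`. [folklore] -/
theorem tendsto_eGradNormSq_fourierTruncate_sub_vecConv {v : UnitAddTorus d → EuclideanSpace ℝ d}
    (hv : Integrable v volume) (N : ℕ) {ε : ℕ → ℝ} (hε : ∀ n, 0 < ε n) (hε' : ∀ n, ε n ≤ 1 / 4)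
    (hε0 : Tendsto ε atTop (𝓝 0)) :
    Tendsto (fun n => FunctionSpaces.Torus.eGradNormSq (FunctionSpaces.Torus.fourierTruncate N v -
      vecConv (FunctionSpaces.Torus.fourierTruncate N v) (FunctionSpaces.Torus.kernel (ε n)))) atTop (𝓝 0) := by
  classical
  set Φ := FunctionSpaces.Torus.fourierTruncate N v with hΦ
  have hΦi : Integrable Φ volume := (FunctionSpaces.Torus.isSmooth_fourierTruncate N v).integrable
  have hKc : ∀ n, Continuous (FunctionSpaces.Torus.kernel (d := d) (ε n)) := fun n =>
    FunctionSpaces.Torus.continuous_kernel (hε n) (hε' n)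
  set c : (d → ℤ) → EuclideanSpace ℂ d := fun k => mFourierCoeff (FunctionSpaces.EuclideanSpace.complexify ∘ v) k with hc
  set κ : ℕ → (d → ℤ) → ℂ := fun n k => mFourierCoeff (fun x => (FunctionSpaces.Torus.kernel (ε n) x : ℂ)) k with hκ
  -- the coefficients of the error
  have hcoef : ∀ n k, mFourierCoeff (FunctionSpaces.EuclideanSpace.complexify ∘
      (Φ - vecConv Φ (FunctionSpaces.Torus.kernel (ε n)))) k =
      if k ∈ FunctionSpaces.Torus.freqBall N then (1 - κ n k) • c k else 0 := by
    intro n k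
    have hint : Integrable (vecConv Φ (FunctionSpaces.Torus.kernel (ε n))) volume :=
      (continuous_vecConv hΦi (hKc n)).integrable_unitAddTorus
    rw [Torus.mFourierCoeff_complexify_sub hΦi hint k, mFourierCoeff_complexify_vecConv hΦi (hKc n) k, hΦ,
      FunctionSpaces.Torus.mFourierCoeff_fourierTruncate hv]
    by_cases hk : k ∈ FunctionSpaces.Torus.freqBall N
    · simp only [if_pos hk, sub_smul, one_smul]
      rfl
    · simp only [if_neg hk, smul_zero, sub_zero]
  -- the dissipation of the error as a finite sum
  have hformula : ∀ n, FunctionSpaces.Torus.eGradNormSq (Φ - vecConv Φ (FunctionSpaces.Torus.kernel (ε n))) =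
      ENNReal.ofReal (4 * Real.pi ^ 2) * ∑ k ∈ FunctionSpaces.Torus.freqBall N,
        ENNReal.ofReal (FunctionSpaces.Torus.freqNormSq k) * (‖1 - κ n k‖ₑ ^ 2 * ‖c k‖ₑ ^ 2) := by
    intro n
    rw [FunctionSpaces.Torus.eGradNormSq_eq_tsum]
    congr 1
    rw [tsum_eq_sum (s := FunctionSpaces.Torus.freqBall N) fun k hk => by rw [hcoef n k, if_neg hk]; simp]
    refine Finset.sum_congr rfl fun k hk => ?_
    rw [hcoef n k, if_pos hk, enorm_smul, mul_pow]
  simp_rw [hformula]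
  -- each term tends to zero
  have hκ1 : ∀ k, Tendsto (fun n => ‖1 - κ n k‖ₑ ^ 2) atTop (𝓝 0) := by
    intro k
    have h1 : Tendsto (fun n => κ n k) atTop (𝓝 1) := tendsto_mFourierCoeff_kernel hε hε' hε0 k
    have h2 : Tendsto (fun n => ‖1 - κ n k‖ₑ) atTop (𝓝 0) := by
      have h := (tendsto_iff_edist_tendsto_0.1 h1)
      refine h.congr fun n => ?_
      rw [edist_comm, edist_eq_enorm_sub]
    have h3 := ((ENNReal.continuous_pow 2).tendsto 0).comp h2
    rwa [zero_pow two_ne_zero] at h3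
  have hterm : ∀ k, Tendsto (fun n => ENNReal.ofReal (FunctionSpaces.Torus.freqNormSq k) * (‖1 - κ n k‖ₑ ^ 2 * ‖c k‖ₑ ^ 2))
      atTop (𝓝 0) := by
    intro k
    have hck : ‖c k‖ₑ ^ 2 ≠ ⊤ := ENNReal.pow_ne_top enorm_ne_top
    have h1 := ENNReal.Tendsto.mul_const (hκ1 k) (Or.inr hck)
    rw [zero_mul] at h1
    have h2 := ENNReal.Tendsto.const_mul (a := ENNReal.ofReal (FunctionSpaces.Torus.freqNormSq k)) h1 (Or.inr ENNReal.ofReal_ne_top)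
    rwa [mul_zero] at h2
  have hsum : Tendsto (fun n => ∑ k ∈ FunctionSpaces.Torus.freqBall N,
      ENNReal.ofReal (FunctionSpaces.Torus.freqNormSq k) * (‖1 - κ n k‖ₑ ^ 2 * ‖c k‖ₑ ^ 2)) atTop (𝓝 0) := by
    have h := tendsto_finsetSum (FunctionSpaces.Torus.freqBall N) (fun k _ => hterm k)
    rwa [Finset.sum_const_zero] at h
  have h := ENNReal.Tendsto.const_mul (a := ENNReal.ofReal (4 * Real.pi ^ 2)) hsum (Or.inr ENNReal.ofReal_ne_top)
  rwa [mul_zero] at h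

end Kernels

/-! ### The nonlinear term against the own truncation, in every dimension -/

section Trilinear

omit [DecidableEq d] in
/-- Componentwise smoothness of the mollification of an integrable vector field by a smooth
kernel (`Torus.isSmooth_convolution` in each coordinate; as `Torus.isSmooth_vecConv` of
`FluidPDE/DuchonRobertCubicIdentity`, not imported here). [folklore] -/
theorem isSmooth_vecConv_of_integrable {F : UnitAddTorus d → EuclideanSpace ℝ d} (hF : Integrable F volume)
    {K : UnitAddTorus d → ℝ} (hK : FunctionSpaces.Torus.IsSmooth K) : FunctionSpaces.Torus.IsSmooth (vecConv F K) := by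
  rw [FunctionSpaces.Torus.IsSmooth, contDiff_euclidean]
  intro i
  exact FunctionSpaces.Torus.isSmooth_convolution (hF.eval_piLp i) hK

omit [DecidableEq d] in
/-- `‖f‖_{L⁴} = (∫⁻ ‖f‖ₑ⁴)^{1/4}`. [folklore] -/
theorem eLpNorm_four_eq_lintegral_rpow {f : UnitAddTorus d → EuclideanSpace ℝ d} :
    eLpNorm f 4 volume = (∫⁻ x, ‖f x‖ₑ ^ 4) ^ (1 / 4 : ℝ) := by
  rw [eLpNorm_eq_lintegral_rpow_enorm_toReal (by norm_num : (4 : ℝ≥0∞) ≠ 0) ENNReal.ofNat_ne_top, ENNReal.toReal_ofNat]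
  simp only [ENNReal.rpow_ofNat]

/-- **The nonlinear term against the own truncation is controlled by the truncation error of the
gradient, in every dimension.** Let `v ∈ L² ∩ L⁴(T^d; ℝ^d)` be weakly divergence free with
`‖∇v‖₂ < ∞` (spectrally). Then for every `N`
`‖∫ ⟪v, (v·∇)P_N v⟫‖ₑ ≤ ‖v‖_{L⁴}² ‖∇(P_N v - v)‖₂` —
the rigorous form of `b(v, v, P_N v) = -b(v, v, v - P_N v)` (`b(v,v,v) = 0`). Proof by
mollification (Serrin 1963, §4; Shinbrot 1974): with the torus mollifiers `Kₙ = kernel εₙ`,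
`εₙ → 0`, split `P_N v = (P_N v - P_N v ⋆ Kₙ) + (P_N v - v) ⋆ Kₙ + v ⋆ Kₙ`; against `v ⊗ v` the
first field contributes `≤ ‖v‖₄² ‖∇(P_N v - P_N v ⋆ Kₙ)‖₂ → 0`
(`Torus.tendsto_eGradNormSq_fourierTruncate_sub_vecConv`), the second
`≤ ‖v‖₄² ‖∇((P_N v - v) ⋆ Kₙ)‖₂ ≤ ‖v‖₄² ‖∇(P_N v - v)‖₂` (`Torus.eGradNormSq_vecConv_le`), and
the third equals `∫⟪v - v ⋆ Kₙ, (v·∇)(v ⋆ Kₙ)⟫` by weak incompressibility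
(`Torus.integral_inner_self_convect_eq_zero_of_isWeaklyDivFree`), bounded by
`‖v - v ⋆ Kₙ‖₄ ‖v‖₄ ‖∇v‖₂ → 0` (`L⁴` approximate identity,
`Torus.tendsto_eLpNorm_vecConv_sub_self_of_kernels`). [cite: Serrin1963, §4 (proof of Thm. 6)] -/
theorem enorm_integral_inner_convect_fourierTruncate_self_le_of_isWeaklyDivFree
    {v : UnitAddTorus d → EuclideanSpace ℝ d} (hv : MemLp v 2 volume) (hv4 : MemLp v 4 volume)
    (hH : FunctionSpaces.Torus.eGradNormSq v < ⊤) (hdiv : FunctionSpaces.Torus.IsWeaklyDivFree v) (N : ℕ) :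
    ‖∫ x, ⟪v x, FunctionSpaces.Torus.convect v (FunctionSpaces.Torus.fourierTruncate N v) x⟫‖ₑ ≤
      (∫⁻ x, ‖v x‖ₑ ^ 4) ^ (1 / 2 : ℝ) *
        FunctionSpaces.Torus.eGradNormSq (FunctionSpaces.Torus.fourierTruncate N v - v) ^ (1 / 2 : ℝ) := by
  -- ### scales and kernels
  set ε : ℕ → ℝ := fun n => 1 / (4 * ((n : ℝ) + 1)) with hεdef
  have hεpos : ∀ n, 0 < ε n := fun n => by rw [hεdef]; positivity
  have hεle : ∀ n, ε n ≤ 1 / 4 := fun n => by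
    rw [hεdef]
    dsimp only
    rw [div_le_div_iff₀ (by positivity) (by norm_num)]
    nlinarith [(Nat.cast_nonneg n : (0 : ℝ) ≤ n)]
  have hε0 : Tendsto ε atTop (𝓝 0) := by
    have h1 : Tendsto (fun n : ℕ => 4 * ((n : ℝ) + 1)) atTop atTop :=
      (tendsto_atTop_add_const_right _ 1 tendsto_natCast_atTop_atTop).const_mul_atTop (by norm_num)
    have h2 := h1.inv_tendsto_atTop
    refine h2.congr fun n => ?_
    simp only [hεdef, Pi.inv_apply, one_div]
  set K : ℕ → UnitAddTorus d → ℝ := fun n => FunctionSpaces.Torus.kernel (ε n) with hKdef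
  have hKc : ∀ n, Continuous (K n) := fun n => FunctionSpaces.Torus.continuous_kernel (hεpos n) (hεle n)
  have hKs : ∀ n, FunctionSpaces.Torus.IsSmooth (K n) := fun n => FunctionSpaces.Torus.isSmooth_kernel (hεpos n) (hεle n)
  have hK0 : ∀ n y, 0 ≤ K n y := fun n y => FunctionSpaces.Torus.kernel_nonneg (hεpos n).le y
  have hK1 : ∀ n, ∫ y, K n y = 1 := fun n => FunctionSpaces.Torus.integral_kernel (hεpos n) (hεle n)
  have hKsupp : ∀ n, support (K n) ⊆ ball 0 (ε n) := fun n => FunctionSpaces.Torus.support_kernel_subset (hεpos n)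
  -- ### the fields
  set Φ := FunctionSpaces.Torus.fourierTruncate N v with hΦ
  have hΦs : FunctionSpaces.Torus.IsSmooth Φ := FunctionSpaces.Torus.isSmooth_fourierTruncate N v
  have hΦi : Integrable Φ volume := hΦs.integrable
  have hvi : Integrable v volume := hv.integrable one_le_two
  have hwi : Integrable (Φ - v) volume := hΦi.sub hvi
  set A : ℕ → UnitAddTorus d → EuclideanSpace ℝ d := fun n => Φ - vecConv Φ (K n) with hA
  set B : ℕ → UnitAddTorus d → EuclideanSpace ℝ d := fun n => vecConv (Φ - v) (K n) with hB
  set C : ℕ → UnitAddTorus d → EuclideanSpace ℝ d := fun n => vecConv v (K n) with hC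
  have hAs : ∀ n, FunctionSpaces.Torus.IsSmooth (A n) := fun n => hΦs.sub (isSmooth_vecConv_of_integrable hΦi (hKs n))
  have hBs : ∀ n, FunctionSpaces.Torus.IsSmooth (B n) := fun n => isSmooth_vecConv_of_integrable hwi (hKs n)
  have hCs : ∀ n, FunctionSpaces.Torus.IsSmooth (C n) := fun n => isSmooth_vecConv_of_integrable hvi (hKs n)
  have hΦABC : ∀ n, Φ = A n + B n + C n := by
    intro n
    rw [hA, hB, hC]
    dsimp only
    rw [vecConv_sub hΦi hvi (hKc n)]
    abel
  -- ### the decomposition of the pairing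
  have hconv : ∀ n x, FunctionSpaces.Torus.convect v Φ x =
      FunctionSpaces.Torus.convect v (A n) x + FunctionSpaces.Torus.convect v (B n) x + FunctionSpaces.Torus.convect v (C n) x := by
    intro n x
    conv_lhs => rw [hΦABC n]
    rw [FunctionSpaces.Torus.convect, FunctionSpaces.Torus.convect, FunctionSpaces.Torus.convect, FunctionSpaces.Torus.convect,
      FunctionSpaces.Torus.fderiv_add (((hAs n).add (hBs n)).isContDiff (by simp)) ((hCs n).isContDiff (by simp)),
      FunctionSpaces.Torus.fderiv_add ((hAs n).isContDiff (by simp)) ((hBs n).isContDiff (by simp))]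
    rfl
  have hsplit : ∀ n, ∫ x, ⟪v x, FunctionSpaces.Torus.convect v Φ x⟫ =
      (∫ x, ⟪v x, FunctionSpaces.Torus.convect v (A n) x⟫) + (∫ x, ⟪v x, FunctionSpaces.Torus.convect v (B n) x⟫) +
        ∫ x, ⟪v x, FunctionSpaces.Torus.convect v (C n) x⟫ := by
    intro n
    have iA := integrable_inner_convect' hv hv (hAs n)
    have iB := integrable_inner_convect' hv hv (hBs n)
    have iC := integrable_inner_convect' hv hv (hCs n)
    have iAB : Integrable (fun x => ⟪v x, FunctionSpaces.Torus.convect v (A n) x⟫ + ⟪v x, FunctionSpaces.Torus.convect v (B n) x⟫) volume :=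
      iA.add iB
    rw [← integral_add iA iB, ← integral_add iAB iC]
    refine integral_congr_ae (ae_of_all _ fun x => ?_)
    beta_reduce
    rw [hconv n x, inner_add_right, inner_add_right]
  -- ### the `L⁴` mass and its finiteness
  set U4 : ℝ≥0∞ := ∫⁻ x, ‖v x‖ₑ ^ 4 with hU4
  have hU4fin : U4 ≠ ⊤ := by
    have h := lintegral_rpow_enorm_lt_top_of_eLpNorm_lt_top (by norm_num : (4 : ℝ≥0∞) ≠ 0)
      ENNReal.ofNat_ne_top hv4.eLpNorm_lt_top
    simpa only [ENNReal.toReal_ofNat, ENNReal.rpow_ofNat] using h.ne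
  have hsq : U4 ^ (1 / 4 : ℝ) * U4 ^ (1 / 4 : ℝ) = U4 ^ (1 / 2 : ℝ) := by
    rw [← ENNReal.rpow_add_of_nonneg _ _ (by norm_num) (by norm_num)]
    norm_num
  -- ### the three bounds
  have hbA : ∀ n, ‖∫ x, ⟪v x, FunctionSpaces.Torus.convect v (A n) x⟫‖ₑ ≤
      U4 ^ (1 / 2 : ℝ) * FunctionSpaces.Torus.eGradNormSq (A n) ^ (1 / 2 : ℝ) := by
    intro n
    refine (enorm_integral_le_lintegral_enorm _).trans ((lintegral_enorm_inner_convect_le hv.1 hv.1 (hAs n)).trans ?_)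
    rw [hsq]
  have hbB : ∀ n, ‖∫ x, ⟪v x, FunctionSpaces.Torus.convect v (B n) x⟫‖ₑ ≤
      U4 ^ (1 / 2 : ℝ) * FunctionSpaces.Torus.eGradNormSq (Φ - v) ^ (1 / 2 : ℝ) := by
    intro n
    refine (enorm_integral_le_lintegral_enorm _).trans ((lintegral_enorm_inner_convect_le hv.1 hv.1 (hBs n)).trans ?_)
    rw [hsq]
    gcongr
    exact eGradNormSq_vecConv_le hwi (hKc n) (hK0 n) (hK1 n)
  have hbC : ∀ n, ‖∫ x, ⟪v x, FunctionSpaces.Torus.convect v (C n) x⟫‖ₑ ≤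
      (∫⁻ x, ‖vecConv v (K n) x - v x‖ₑ ^ 4) ^ (1 / 4 : ℝ) * (U4 ^ (1 / 4 : ℝ) * FunctionSpaces.Torus.eGradNormSq v ^ (1 / 2 : ℝ)) := by
    intro n
    have hCm : MemLp (C n) 2 volume := (hCs n).memLp 2
    have hvC : MemLp (v - C n) 2 volume := hv.sub hCm
    -- the cancellation
    have heq : ∫ x, ⟪v x, FunctionSpaces.Torus.convect v (C n) x⟫ = ∫ x, ⟪(v - C n) x, FunctionSpaces.Torus.convect v (C n) x⟫ := by
      have hpt : ∀ x, ⟪v x, FunctionSpaces.Torus.convect v (C n) x⟫ =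
          ⟪(v - C n) x, FunctionSpaces.Torus.convect v (C n) x⟫ + ⟪C n x, FunctionSpaces.Torus.convect v (C n) x⟫ := by
        intro x; rw [Pi.sub_apply, inner_sub_left]; ring
      simp_rw [hpt]
      rw [integral_add (integrable_inner_convect' hvC hv (hCs n)) (integrable_inner_convect' hCm hv (hCs n)),
        integral_inner_self_convect_eq_zero_of_isWeaklyDivFree hdiv (hCs n), add_zero]
    rw [heq]
    refine (enorm_integral_le_lintegral_enorm _).trans ((lintegral_enorm_inner_convect_le hvC.1 hv.1 (hCs n)).trans ?_)
    have hR : (∫⁻ x, ‖(v - C n) x‖ₑ ^ 4) = ∫⁻ x, ‖vecConv v (K n) x - v x‖ₑ ^ 4 :=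
      lintegral_congr fun x => by rw [Pi.sub_apply, enorm_sub_rev]
    rw [hR, mul_assoc]
    gcongr
    exact eGradNormSq_vecConv_le hvi (hKc n) (hK0 n) (hK1 n)
  -- ### the vanishing bounds
  have hlimA : Tendsto (fun n => U4 ^ (1 / 2 : ℝ) * FunctionSpaces.Torus.eGradNormSq (A n) ^ (1 / 2 : ℝ)) atTop (𝓝 0) := by
    have h1 : Tendsto (fun n => FunctionSpaces.Torus.eGradNormSq (A n)) atTop (𝓝 0) :=
      tendsto_eGradNormSq_fourierTruncate_sub_vecConv hvi N hεpos hεle hε0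
    have h2 : Tendsto (fun n => FunctionSpaces.Torus.eGradNormSq (A n) ^ (1 / 2 : ℝ)) atTop (𝓝 0) := by
      have hc := (ENNReal.continuous_rpow_const (y := (1 / 2 : ℝ))).tendsto 0
      rw [ENNReal.zero_rpow_of_pos (by norm_num)] at hc
      exact hc.comp h1
    have h3 := ENNReal.Tendsto.const_mul (a := U4 ^ (1 / 2 : ℝ)) h2
      (Or.inr (ENNReal.rpow_ne_top_of_nonneg (by norm_num) hU4fin))
    rwa [mul_zero] at h3
  have hlimC : Tendsto (fun n => (∫⁻ x, ‖vecConv v (K n) x - v x‖ₑ ^ 4) ^ (1 / 4 : ℝ) *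
      (U4 ^ (1 / 4 : ℝ) * FunctionSpaces.Torus.eGradNormSq v ^ (1 / 2 : ℝ))) atTop (𝓝 0) := by
    have h1 : Tendsto (fun n => eLpNorm (vecConv v (K n) - v) 4 volume) atTop (𝓝 0) :=
      tendsto_eLpNorm_vecConv_sub_self_of_kernels (by norm_num) ENNReal.ofNat_ne_top hv4 hK0 hK1 hKsupp hKc hε0
    have h2 : Tendsto (fun n => (∫⁻ x, ‖vecConv v (K n) x - v x‖ₑ ^ 4) ^ (1 / 4 : ℝ)) atTop (𝓝 0) := by
      refine h1.congr fun n => ?_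
      rw [eLpNorm_four_eq_lintegral_rpow]
      rfl
    have hfac : U4 ^ (1 / 4 : ℝ) * FunctionSpaces.Torus.eGradNormSq v ^ (1 / 2 : ℝ) ≠ ⊤ :=
      ENNReal.mul_ne_top (ENNReal.rpow_ne_top_of_nonneg (by norm_num) hU4fin)
        (ENNReal.rpow_ne_top_of_nonneg (by norm_num) hH.ne)
    have h3 := ENNReal.Tendsto.mul_const h2 (Or.inr hfac)
    rwa [zero_mul] at h3
  -- ### conclusion: let `n → ∞` in `‖∫⟪v,(v·∇)Φ⟫‖ₑ ≤ a n + b + c n`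
  have hbound : ∀ n, ‖∫ x, ⟪v x, FunctionSpaces.Torus.convect v Φ x⟫‖ₑ ≤
      U4 ^ (1 / 2 : ℝ) * FunctionSpaces.Torus.eGradNormSq (A n) ^ (1 / 2 : ℝ) +
        U4 ^ (1 / 2 : ℝ) * FunctionSpaces.Torus.eGradNormSq (Φ - v) ^ (1 / 2 : ℝ) +
        (∫⁻ x, ‖vecConv v (K n) x - v x‖ₑ ^ 4) ^ (1 / 4 : ℝ) * (U4 ^ (1 / 4 : ℝ) * FunctionSpaces.Torus.eGradNormSq v ^ (1 / 2 : ℝ)) := by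
    intro n
    rw [hsplit n]
    exact ((enorm_add_le _ _).trans (add_le_add (enorm_add_le _ _) le_rfl)).trans
      (add_le_add (add_le_add (hbA n) (hbB n)) (hbC n))
  have hlim := (hlimA.add (tendsto_const_nhds
    (x := U4 ^ (1 / 2 : ℝ) * FunctionSpaces.Torus.eGradNormSq (Φ - v) ^ (1 / 2 : ℝ)))).add hlimC
  rw [zero_add, add_zero] at hlim
  exact ge_of_tendsto' hlim hbound

/-- **The dissipation of the truncation error vanishes**: `‖∇(P_N v - v)‖₂² → 0` as `N → ∞` for
`v ∈ L²` with `‖∇v‖₂ < ∞` (the tail `4π² ∑_{|k|>N} |k|² ‖v̂(k)‖²` of a convergent series). [folklore] -/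
theorem tendsto_eGradNormSq_fourierTruncate_sub {v : UnitAddTorus d → EuclideanSpace ℝ d}
    (hv : MemLp v 2 volume) (hH : FunctionSpaces.Torus.eGradNormSq v < ⊤) :
    Tendsto (fun N => FunctionSpaces.Torus.eGradNormSq (FunctionSpaces.Torus.fourierTruncate N v - v)) atTop (𝓝 0) := by
  set F : (d → ℤ) → ℝ≥0∞ := fun k => ENNReal.ofReal (FunctionSpaces.Torus.freqNormSq k) *
    ‖mFourierCoeff (FunctionSpaces.EuclideanSpace.complexify ∘ v) k‖ₑ ^ 2 with hF
  have hHF : FunctionSpaces.Torus.eGradNormSq v = ENNReal.ofReal (4 * Real.pi ^ 2) * ∑' k, F k :=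
    FunctionSpaces.Torus.eGradNormSq_eq_tsum v
  have hFsum : ∑' k, F k ≠ ⊤ := by
    intro htop
    rw [hHF, htop, ENNReal.mul_top (by positivity)] at hH
    exact lt_irrefl _ hH
  set Tl : ℕ → ℝ≥0∞ := fun N => ∑' k : {k : d → ℤ // k ∉ FunctionSpaces.Torus.freqBall N}, F k with hTl
  have hTl0 : Tendsto Tl atTop (𝓝 0) :=
    (ENNReal.tendsto_tsum_compl_atTop_zero hFsum).comp FunctionSpaces.Torus.tendsto_freqBall_atTop
  have hformula : ∀ N, FunctionSpaces.Torus.eGradNormSq (FunctionSpaces.Torus.fourierTruncate N v - v) =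
      ENNReal.ofReal (4 * Real.pi ^ 2) * Tl N := by
    intro N
    rw [FunctionSpaces.Torus.eGradNormSq_eq_tsum]
    congr 1
    rw [hTl]
    dsimp only
    rw [show (∑' k : {k : d → ℤ // k ∉ FunctionSpaces.Torus.freqBall N}, F k) =
        ∑' k : ({k : d → ℤ | k ∉ FunctionSpaces.Torus.freqBall N} : Set (d → ℤ)), F k from rfl,
      tsum_subtype ({k : d → ℤ | k ∉ FunctionSpaces.Torus.freqBall N} : Set (d → ℤ)) F]
    refine tsum_congr fun k => ?_
    rw [FunctionSpaces.Torus.mFourierCoeff_fourierTruncate_sub (hv.integrable one_le_two)]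
    simp only [Set.indicator_apply, Set.mem_setOf_eq, hF]
    by_cases hk : k ∈ FunctionSpaces.Torus.freqBall N
    · simp [hk]
    · simp [hk]
  simp_rw [hformula]
  have h := ENNReal.Tendsto.const_mul (a := ENNReal.ofReal (4 * Real.pi ^ 2)) hTl0 (Or.inr ENNReal.ofReal_ne_top)
  rwa [mul_zero] at h

end Trilinear

/-! ### The nonlinear term in time, in every dimension -/

section TimeLimit

variable {T ν : ℝ} {f u : ℝ → UnitAddTorus d → EuclideanSpace ℝ d}
  {u₀ : UnitAddTorus d → EuclideanSpace ℝ d}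

/-- **The nonlinear term of the truncated identity vanishes in the limit, in every dimension**
(Lions 1960; Shinbrot 1974): for a Leray–Hopf solution on `T^d` with `u ∈ L⁴(0,T; L⁴)` and every
`t ∈ (0, T]`, `∫_{(0,t]} ∫⟪u, (u·∇)P_N u⟫ ds → 0` as `N → ∞` — dominated convergence in time: the
slice term is bounded by `‖u(s)‖₄² ‖∇(P_N u(s) - u(s))‖₂ → 0`
(`Torus.enorm_integral_inner_convect_fourierTruncate_self_le_of_isWeaklyDivFree`,
`Torus.tendsto_eGradNormSq_fourierTruncate_sub`) and dominated by `‖u(s)‖₄² ‖∇u(s)‖₂ ∈ L¹(0,T)`;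
twin of `Torus.IsLerayHopfOn.tendsto_setIntegral_inner_convect_fourierTruncate_self` without the
dimensional restriction. [cite: Shinbrot1974, Thm. (proof)] -/
theorem IsLerayHopfOn.tendsto_setIntegral_inner_convect_fourierTruncate_self' (hu : IsLerayHopfOn T ν f u₀ u)
    (hu4 : MemLqLp 4 4 u (Ioo 0 T)) {t : ℝ} (ht : t ∈ Ioc 0 T) :
    (∀ N, IntegrableOn (fun s =>
        ∫ x, ⟪u s x, FunctionSpaces.Torus.convect (u s) (FunctionSpaces.Torus.fourierTruncate N (u s)) x⟫) (Ioc 0 t)) ∧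
    Tendsto (fun N => ∫ s in Ioc 0 t,
        ∫ x, ⟪u s x, FunctionSpaces.Torus.convect (u s) (FunctionSpaces.Torus.fourierTruncate N (u s)) x⟫)
      atTop (𝓝 0) := by
  set μT : Measure ℝ := volume.restrict (Ioo 0 T) with hμT
  set μt : Measure ℝ := volume.restrict (Ioo 0 t) with hμt
  have hsub : Ioo 0 t ⊆ Ioo 0 T := Ioo_subset_Ioo le_rfl ht.2
  have hle : μt ≤ μT := Measure.restrict_mono hsub le_rfl
  -- ### time densities
  set U4 : ℝ → ℝ≥0∞ := fun s => ∫⁻ x, ‖u s x‖ₑ ^ 4 with hU4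
  set g : ℝ → ℝ≥0∞ := fun s => FunctionSpaces.Torus.eGradNormSq (u s) with hg
  set B : ℝ → ℝ≥0∞ := fun s => U4 s ^ (1 / 2 : ℝ) * g s ^ (1 / 2 : ℝ) with hB
  set F : ℕ → ℝ → ℝ := fun N s =>
    ∫ x, ⟪u s x, FunctionSpaces.Torus.convect (u s) (FunctionSpaces.Torus.fourierTruncate N (u s)) x⟫ with hF
  -- ### measurability
  have hU4m : AEMeasurable U4 μT := hu.aemeasurable_lintegral_enorm_pow 4
  have hgm : AEMeasurable g μT := hu.aemeasurable_eGradNormSq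
  have hBm : AEMeasurable B μT := (hU4m.pow_const _).mul (hgm.pow_const _)
  have hu' := hu.aestronglyMeasurable_uncurry
  have hu't : AEStronglyMeasurable (uncurry u) (μt.prod volume) :=
    hu'.mono_measure (Measure.prod_mono hle le_rfl)
  have hFm : ∀ N, AEStronglyMeasurable (F N) μt := fun N =>
    aestronglyMeasurable_integral_inner_convect_fourierTruncate hu't hu't hu't N
  -- ### finiteness
  have hU4fin : ∫⁻ s, U4 s ∂μT < ⊤ := lintegral_lintegral_enorm_pow_four_lt_top_of_memLqLp hu4
  have hgfin : ∫⁻ s, g s ∂μT < ⊤ := hu.lintegral_eGradNormSq_lt_top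
  have hBfin : ∫⁻ s, B s ∂μt ≠ ⊤ := by
    have h := ENNReal.lintegral_mul_le_Lp_mul_Lq μt Real.HolderConjugate.two_two
      ((hU4m.mono_measure hle).pow_const (1 / 2 : ℝ)) ((hgm.mono_measure hle).pow_const (1 / 2 : ℝ))
    have e : ∀ x : ℝ≥0∞, (x ^ (1 / 2 : ℝ)) ^ (2 : ℝ) = x := fun x => by
      rw [← ENNReal.rpow_mul]; norm_num
    simp only [Pi.mul_apply, e] at h
    refine ne_top_of_le_ne_top (ENNReal.mul_ne_top ?_ ?_) h
    · exact ENNReal.rpow_ne_top_of_nonneg (by norm_num) ((lintegral_mono' hle le_rfl).trans_lt hU4fin).ne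
    · exact ENNReal.rpow_ne_top_of_nonneg (by norm_num) ((lintegral_mono' hle le_rfl).trans_lt hgfin).ne
  have hbound_int : Integrable (fun s => (B s).toReal) μt :=
    integrable_toReal_of_lintegral_ne_top (hBm.mono_measure hle) hBfin
  -- ### a.e. finiteness of the densities on `(0, t)`
  have hU4ae : ∀ᵐ s ∂μt, U4 s < ⊤ := (ae_lt_top' hU4m hU4fin.ne).filter_mono (ae_mono hle)
  have hgae : ∀ᵐ s ∂μt, g s < ⊤ := (ae_lt_top' hgm hgfin.ne).filter_mono (ae_mono hle)
  -- ### domination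
  have h_bound : ∀ N, ∀ᵐ s ∂μt, ‖F N s‖ ≤ (B s).toReal := by
    intro N
    filter_upwards [hU4ae, hgae, ae_restrict_mem measurableSet_Ioo] with s hU hG hs
    have hmem : MemLp (u s) 2 volume := hu.memLp s (Ioo_subset_Icc_self (hsub hs))
    have h1 := enorm_integral_inner_convect_fourierTruncate_self_le' hmem N
    have hBs : B s ≠ ⊤ := ENNReal.mul_ne_top (ENNReal.rpow_ne_top_of_nonneg (by norm_num) hU.ne)
      (ENNReal.rpow_ne_top_of_nonneg (by norm_num) hG.ne)
    have h2 := ENNReal.toReal_mono hBs h1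
    rwa [Real.enorm_eq_ofReal_abs, ENNReal.toReal_ofReal (abs_nonneg _), ← Real.norm_eq_abs] at h2
  -- ### slice convergence for a.e. time
  have h_lim : ∀ᵐ s ∂μt, Tendsto (fun N => F N s) atTop (𝓝 0) := by
    have h4ae : ∀ᵐ s ∂μT, MemLp (u s) 4 volume := hu4.1
    filter_upwards [h4ae.filter_mono (ae_mono hle), hgae, ae_restrict_mem measurableSet_Ioo] with s h4 hG hs
    have hsT : s ∈ Ioc 0 T := ⟨hs.1, hs.2.le.trans ht.2⟩
    have hmem : MemLp (u s) 2 volume := hu.memLp s (Ioc_subset_Icc_self hsT)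
    have hdiv := hu.isWeaklyDivFree_of_mem_Ioc hsT
    -- the truncation error of the gradient vanishes
    have hR := tendsto_eGradNormSq_fourierTruncate_sub hmem hG
    -- finiteness of the fixed factor
    have hU4s : U4 s ≠ ⊤ := by
      have h := lintegral_rpow_enorm_lt_top_of_eLpNorm_lt_top (by norm_num : (4 : ℝ≥0∞) ≠ 0)
        ENNReal.ofNat_ne_top h4.eLpNorm_lt_top
      simpa only [ENNReal.toReal_ofNat, ENNReal.rpow_ofNat] using h.ne
    have hfac : U4 s ^ (1 / 2 : ℝ) ≠ ⊤ := ENNReal.rpow_ne_top_of_nonneg (by norm_num) hU4s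
    -- the bound and its limit
    have hbd : ∀ N, ‖F N s‖ₑ ≤ U4 s ^ (1 / 2 : ℝ) *
        FunctionSpaces.Torus.eGradNormSq (FunctionSpaces.Torus.fourierTruncate N (u s) - u s) ^ (1 / 2 : ℝ) := fun N =>
      enorm_integral_inner_convect_fourierTruncate_self_le_of_isWeaklyDivFree hmem h4 hG hdiv N
    have hlim0 : Tendsto (fun N => U4 s ^ (1 / 2 : ℝ) *
        FunctionSpaces.Torus.eGradNormSq (FunctionSpaces.Torus.fourierTruncate N (u s) - u s) ^ (1 / 2 : ℝ)) atTop (𝓝 0) := by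
      have h1 : Tendsto (fun N => FunctionSpaces.Torus.eGradNormSq (FunctionSpaces.Torus.fourierTruncate N (u s) - u s) ^ (1 / 2 : ℝ))
          atTop (𝓝 0) := by
        have hc := (ENNReal.continuous_rpow_const (y := (1 / 2 : ℝ))).tendsto 0
        rw [ENNReal.zero_rpow_of_pos (by norm_num)] at hc
        exact hc.comp hR
      have h2 := ENNReal.Tendsto.const_mul (a := U4 s ^ (1 / 2 : ℝ)) h1 (Or.inr hfac)
      rwa [mul_zero] at h2
    have hen : Tendsto (fun N => ‖F N s‖ₑ) atTop (𝓝 0) :=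
      tendsto_of_tendsto_of_tendsto_of_le_of_le tendsto_const_nhds hlim0 (fun _ => bot_le) hbd
    -- back to real numbers
    have hnorm : Tendsto (fun N => ‖F N s‖) atTop (𝓝 0) := by
      have h := (ENNReal.tendsto_toReal ENNReal.zero_ne_top).comp hen
      rw [ENNReal.toReal_zero] at h
      refine h.congr fun N => ?_
      rw [Function.comp_apply, Real.enorm_eq_ofReal_abs, ENNReal.toReal_ofReal (abs_nonneg _), Real.norm_eq_abs]
    exact tendsto_zero_iff_norm_tendsto_zero.2 hnorm
  -- ### integrability and dominated convergence
  have hInt : ∀ N, IntegrableOn (F N) (Ioc 0 t) := fun N => by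
    rw [IntegrableOn, ← Measure.restrict_congr_set Ioo_ae_eq_Ioc]
    exact hbound_int.mono' (hFm N) (h_bound N)
  refine ⟨hInt, ?_⟩
  have hDC := tendsto_integral_of_dominated_convergence (fun s => (B s).toReal) hFm hbound_int h_bound h_lim
  rw [integral_zero] at hDC
  refine hDC.congr fun N => ?_
  rw [hμt, setIntegral_congr_set Ioo_ae_eq_Ioc]

end TimeLimit

end Torus

/-! ### Lions' energy equality on `T^d`, every dimension -/

section General

variable {d : Type*} [Fintype d] [DecidableEq d] {T ν : ℝ}
  {f u : ℝ → UnitAddTorus d → EuclideanSpace ℝ d} {u₀ : UnitAddTorus d → EuclideanSpace ℝ d}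

/-- **Lions' energy equality on `T^d × (0, T]` in every dimension** — the corrected form of the
refuted `Literature.Analysis.FluidPDE.lions_energy_equality` without the dimensional restriction
of `Literature.Analysis.FluidPDE.lions_energy_equality_Ioc` (J.-L. Lions, Rend. Sem. Mat. Univ.
Padova 30 (1960); Shinbrot, SIAM J. Math. Anal. 5 (1974), Thm., case `p = r = 4`, whose
time-mollification proof is dimension-free). Let `u` be a Leray–Hopf weak solution of the forced
Navier–Stokes/Euler system on `T^d × [0, T)` (`Torus.IsLerayHopfOn`) with datum `u₀ ∈ L²`, a
jointly measurable force `f ∈ L¹(0,T; L²)`, and `u ∈ L⁴(0,T; L⁴)`. Then for **every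
`t ∈ (0, T]`**, `½‖u(t)‖² + ν ∫₀ᵗ ‖∇u‖₂² = ½‖u₀‖² + ∫₀ᵗ∫ ⟪f, u⟫` (spectral dissipation
`Torus.eGradNormSq`). Same Galerkin proof as `lions_energy_equality_Ioc`; the only change is the
slice-level control of the nonlinear term, now by mollification
(`Torus.enorm_integral_inner_convect_fourierTruncate_self_le_of_isWeaklyDivFree`:
`‖∫⟪u,(u·∇)P_N u⟫‖ ≤ ‖u‖₄² ‖∇(P_N u - u)‖₂`). [cite: Shinbrot1974, Thm. (p = r = 4: Lions 1960)] -/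
theorem lions_energy_equality_Ioc' (hLH : Torus.IsLerayHopfOn T ν f u₀ u) (hu₀ : MemLp u₀ 2 volume)
    (hu4 : Torus.MemLqLp 4 4 u (Ioo 0 T))
    (hfm : AEStronglyMeasurable (FunctionSpaces.Torus.stLift f) (volume.restrict (Ioo 0 T ×ˢ univ)))
    (hf : Torus.MemLqLp 1 2 f (Ioo 0 T)) :
    ∀ t ∈ Ioc 0 T,
      FunctionSpaces.Torus.kineticEnergy (u t) + ν * (∫⁻ τ in Ioo 0 t, FunctionSpaces.Torus.eGradNormSq (u τ)).toReal =
        FunctionSpaces.Torus.kineticEnergy u₀ + ∫ τ in 0..t, ∫ x, ⟪f τ x, u τ x⟫ := by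
  intro t ht
  have hT : 0 < T := ht.1.trans_le ht.2
  have ht' : t ∈ Icc 0 T := ⟨ht.1.le, ht.2⟩
  -- ### the five sequences
  set L : ℕ → ℝ := fun N => ∫ x, ⟪FunctionSpaces.Torus.fourierTruncate N (u t) x, FunctionSpaces.Torus.fourierTruncate N (u t) x⟫ with hL
  set L₀ : ℕ → ℝ := fun N => ∫ x, ⟪FunctionSpaces.Torus.fourierTruncate N u₀ x, FunctionSpaces.Torus.fourierTruncate N u₀ x⟫ with hL₀
  set NL : ℕ → ℝ := fun N => ∫ s in Ioc 0 t,
    ∫ x, ⟪u s x, FunctionSpaces.Torus.convect (u s) (FunctionSpaces.Torus.fourierTruncate N (u s)) x⟫ with hNL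
  set D : ℕ → ℝ := fun N => ∫ s in Ioc 0 t,
    (FunctionSpaces.Torus.eGradNormSq (FunctionSpaces.Torus.fourierTruncate N (u s))).toReal with hD
  set W : ℕ → ℝ := fun N => ∫ s in Ioc 0 t, ∫ x, ⟪f s x, FunctionSpaces.Torus.fourierTruncate N (u s) x⟫ with hW
  obtain ⟨hNLint, hNLlim⟩ := hLH.tendsto_setIntegral_inner_convect_fourierTruncate_self' hu4 ht
  obtain ⟨hDint, hDlim⟩ := hLH.tendsto_setIntegral_toReal_eGradNormSq_fourierTruncate ht
  obtain ⟨hWint, hWlim⟩ := hLH.tendsto_setIntegral_work_fourierTruncate hfm hf ht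
  -- ### the identity at level `N`
  have hN : ∀ N, L N = L₀ N + 2 * ((NL N - ν * D N) + W N) := by
    intro N
    obtain ⟨hΦint, hid⟩ := hLH.integral_inner_fourierTruncate_self_eq hT hfm hf hu₀ N ht
    have h1 : ∀ᵐ s ∂(volume.restrict (Ioc 0 T)), Integrable (f s) volume := by
      rw [← Measure.restrict_congr_set Ioo_ae_eq_Ioc]
      exact Torus.ae_integrable_force_slice' hf
    have hsplit : ∀ᵐ s ∂(volume.restrict (Ioc 0 t)),
        (∫ x, (⟪u s x, FunctionSpaces.Torus.convect (u s) (FunctionSpaces.Torus.fourierTruncate N (u s)) x⟫ +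
          ν * ⟪u s x, FunctionSpaces.Torus.laplacian (FunctionSpaces.Torus.fourierTruncate N (u s)) x⟫ +
          ⟪f s x, FunctionSpaces.Torus.fourierTruncate N (u s) x⟫)) =
        (∫ x, ⟪u s x, FunctionSpaces.Torus.convect (u s) (FunctionSpaces.Torus.fourierTruncate N (u s)) x⟫) -
          ν * (FunctionSpaces.Torus.eGradNormSq (FunctionSpaces.Torus.fourierTruncate N (u s))).toReal +
          ∫ x, ⟪f s x, FunctionSpaces.Torus.fourierTruncate N (u s) x⟫ := by
      filter_upwards [ae_restrict_of_ae_restrict_of_subset (Ioc_subset_Ioc_right ht.2) h1,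
        ae_restrict_mem measurableSet_Ioc] with s hs hsI
      exact Torus.flux_fourierTruncate_self_split (hLH.memLp s ⟨hsI.1.le, hsI.2.trans ht.2⟩) hs ν N
    have iD : IntegrableOn (fun s => ν * (FunctionSpaces.Torus.eGradNormSq (FunctionSpaces.Torus.fourierTruncate N (u s))).toReal)
        (Ioc 0 t) := (hDint N).const_mul ν
    have iND : IntegrableOn (fun s =>
        (∫ x, ⟪u s x, FunctionSpaces.Torus.convect (u s) (FunctionSpaces.Torus.fourierTruncate N (u s)) x⟫) -
          ν * (FunctionSpaces.Torus.eGradNormSq (FunctionSpaces.Torus.fourierTruncate N (u s))).toReal) (Ioc 0 t) :=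
      (hNLint N).sub iD
    rw [hL, hL₀, hNL, hD, hW]
    dsimp only
    rw [hid, integral_congr_ae hsplit, integral_add iND (hWint N), integral_sub (hNLint N) iD, integral_const_mul]
  -- ### the limits
  have hLlim : Tendsto L atTop (𝓝 (∫ x, ‖u t x‖ ^ 2)) := Torus.tendsto_integral_inner_fourierTruncate_self (hLH.memLp t ht')
  have hL₀lim : Tendsto L₀ atTop (𝓝 (∫ x, ‖u₀ x‖ ^ 2)) := Torus.tendsto_integral_inner_fourierTruncate_self hu₀
  have hRlim : Tendsto (fun N => L₀ N + 2 * ((NL N - ν * D N) + W N)) atTop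
      (𝓝 ((∫ x, ‖u₀ x‖ ^ 2) + 2 * ((0 - ν * (∫⁻ s in Ioo 0 t, FunctionSpaces.Torus.eGradNormSq (u s)).toReal) +
        ∫ s in Ioc 0 t, ∫ x, ⟪f s x, u s x⟫))) :=
    hL₀lim.add (((hNLlim.sub (hDlim.const_mul ν)).add hWlim).const_mul 2)
  have hLlim' : Tendsto L atTop
      (𝓝 ((∫ x, ‖u₀ x‖ ^ 2) + 2 * ((0 - ν * (∫⁻ s in Ioo 0 t, FunctionSpaces.Torus.eGradNormSq (u s)).toReal) +
        ∫ s in Ioc 0 t, ∫ x, ⟪f s x, u s x⟫))) :=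
    hRlim.congr fun N => (hN N).symm
  have key := tendsto_nhds_unique hLlim hLlim'
  -- ### conclusion
  rw [intervalIntegral.integral_of_le ht.1.le]
  simp only [FunctionSpaces.Torus.kineticEnergy]
  linarith

end General

end Literature.Analysis.FluidPDE

end
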